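import Literature.Computability.AlgebraicComplexity.GeneralisedGrenetMatrix
import Literature.Computability.AlgebraicComplexity.GrenetEquivariant
import Mathlib.LinearAlgebra.Matrix.Rank
import Mathlib.Data.Complex.Basic

/-! # Crux `UniqStep` (stmt-ValiantsHypothesis-17834), line `Sketch` (phase 2: the purified source twist) — stub `stub_grenetRank`:
# no coefficient matrix of Grenet's matrix has rank `2` when `n ≥ 4`

WHAT. Let `n = k + 3 ≥ 4`, `m + 1 = 2ⁿ`, `e : Finset (Fin n) ≃ Fin (m + 1)`, and let
`Grenet.repr ℂ n e = ε • ((1 − adj).submatrix e.symm e.symm).submatrix (e univ).succAbove (e ∅).succAbove`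
(`ε = (−1)^(e univ + e ∅)`) be Grenet's `m × m` matrix of `per_n` (`GrenetEquivariant.lean`), with the
row labels `ρ i := e.symm ((e univ).succAbove i) ≠ univ` and the column labels
`κ j := e.symm ((e ∅).succAbove j) ≠ ∅` of `GeneralisedGrenetMatrix.lean`.  We prove that for every
variable `X (p, q)` the coefficient matrix `coeffMat (Grenet.repr ℂ n e) (p, q)` does NOT have rank `2`.
Proof: by `Grenet.coeff_one_sub_arc` (Grenet's arc `S → insert k S` carries `X (k, |S|)`, i.e. the
arc forms are `a S k c = [c = |S|]`) its cell `(i, j)` is `−ε` when `|ρ i| = q`, `p ∉ ρ i` and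
`κ j = insert p (ρ i)`, and `0` otherwise (`coeffMat_repr_eq`): it is `−ε` times the PARTIAL
PERMUTATION matrix of the level-`q` arcs `S → S ∪ {p}` avoiding `p`.  If `q = 0` or `q = n − 1` there is
a single admissible source `S` (`∅`, resp. `univ ∖ {p}`), so the matrix is an outer product and has
rank `≤ 1` (`rank_le_one_of_forall_eq`, `Matrix.rank_vecMulVec_le`); if `1 ≤ q ≤ n − 2` there are
`C(n − 1, q) ≥ n − 1 ≥ 3` admissible sources (`succ_le_choose`, `exists_three_subsets`), three of
which give a `3 × 3` submatrix `−ε • 1` of rank `3` (`three_le_rank_of_injective`,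
`Matrix.rank_submatrix_le`), so the rank is `≥ 3`.

WHY. Stub V7 of the line: in the composition `UniqStep_of` the purified source twist `K_n` is an
honest optimal projection of `per_n` whose `X(0,0)`-coefficient matrix has rank `2` (stubs V5, V6),
the multiset of coefficient ranks is an invariant of the crux's gauge relation (V6), and by the present
stub no coefficient matrix of Grenet's (honest, optimal) matrix has rank `2`; so the two are
inequivalent, the antecedent `Uniq n` of the crux fails at every `n ≥ 4` and `UniqStep` holds
vacuously.

SOURCE. This session's construction (computations `compute/purify_*.py`); Grenet's matrix and its
arc weights are from B. Grenet, *An upper bound for the permanent versus determinant problem* (2011),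
Thm. 1 (`Grenet.adj`, `Grenet.repr`); the `(3, 7)` twist is from J. Hüttenhain, C. Ikenmeyer, *Binary
determinantal complexity*, Linear Algebra Appl. 504 (2016); generalised arc forms are Landsberg–Ressayre
2017, §2.2.  The rank computations here are elementary linear algebra over `ℂ`.
-/

-- D-0017 layout: Sub = Summit for this single-conjunct summit, so the namespace repeats a component.
set_option linter.dupNamespace false

namespace Summit.ValiantsHypothesis.ValiantsHypothesis.Theorems.ProjectionStabilityUniqStep

open MvPolynomial
open scoped BigOperators Matrix
open Literature.Computability.AlgebraicComplexity
open Literature.Computability.AlgebraicComplexity.LRPencil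

noncomputable section

/-! ### The coefficient matrices of Grenet's matrix -/

/-- Grenet's adjacency matrix is the arc matrix of the generalised Grenet matrices of
`GeneralisedGrenetMatrix.lean` for the forms `a S k c := [c = |S|]` (the arc `S → insert k S`
carries `X (k, |S|)`). [cite: Grenet2011, Thm. 1] -/
theorem adj_eq_arc {n : ℕ} (S T : Finset (Fin n)) :
    Grenet.adj ℂ n S T = ∑ k : Fin n, if k ∉ S ∧ T = insert k S
      then ∑ c : Fin n, (if (c : ℕ) = S.card then (1 : ℂ) else 0) •
        (X (k, c) : MvPolynomial (Fin n × Fin n) ℂ) else 0 := by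
  rw [Grenet.adj_apply]
  refine Finset.sum_congr rfl fun j _ => ?_
  split_ifs with h
  · have hc : S.card < n := Grenet.card_lt_of_notMem h.1
    rw [Grenet.wt, dif_pos hc, Finset.sum_eq_single (⟨S.card, hc⟩ : Fin n)]
    · rw [if_pos rfl, one_smul]
    · intro c _ hc'
      rw [if_neg (fun h' => hc' (Fin.ext h')), zero_smul]
    · exact fun h' => absurd (Finset.mem_univ _) h'
  · rfl

/-- **The coefficient matrices of Grenet's matrix are signed partial permutation matrices.** With the
row labels `ρ i := e.symm ((e univ).succAbove i)` and the column labels `κ j := e.symm ((e ∅).succAbove j)`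
of the `(univ, ∅)` minor, the coefficient of `X (p, q)` in the cell `(i, j)` of `Grenet.repr ℂ n e` is
`-(-1)^(e univ + e ∅)` if `|ρ i| = q`, `p ∉ ρ i` and `κ j = insert p (ρ i)` (the arc `ρ i → ρ i ∪ {p}`
of level `q`), and `0` otherwise. [cite: Grenet2011, Thm. 1] -/
theorem coeffMat_repr_eq {n m : ℕ} (e : Finset (Fin n) ≃ Fin (m + 1)) (p q : Fin n) :
    coeffMat (Grenet.repr ℂ n e) (p, q) = Matrix.of fun i j : Fin m =>
      if ((q : ℕ) = (e.symm ((e Finset.univ).succAbove i)).card ∧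
            p ∉ e.symm ((e Finset.univ).succAbove i)) ∧
          e.symm ((e ∅).succAbove j) = insert p (e.symm ((e Finset.univ).succAbove i))
      then -(-1 : ℂ) ^ ((e Finset.univ : ℕ) + (e ∅ : ℕ)) else 0 := by
  ext i j
  rw [coeffMat_apply, Grenet.repr, Matrix.smul_apply, Matrix.submatrix_apply, Matrix.submatrix_apply,
    Grenet.neg_one_pow_eq_C, smul_eq_mul, coeff_C_mul, Grenet.coeff_one_sub_arc adj_eq_arc,
    Matrix.of_apply]
  set ρ := e.symm ((e Finset.univ).succAbove i)
  set κ := e.symm ((e ∅).succAbove j)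
  by_cases h : ((q : ℕ) = ρ.card ∧ p ∉ ρ) ∧ κ = insert p ρ
  · have ha : p ∉ ρ ∧ κ = insert p ρ := ⟨h.1.2, h.2⟩
    rw [if_pos h, if_pos ha, if_pos h.1.1, mul_neg, mul_one]
  · rw [if_neg h]
    by_cases ha : p ∉ ρ ∧ κ = insert p ρ
    · have hq : ¬ (q : ℕ) = ρ.card := fun hq => h ⟨⟨hq, ha.1⟩, ha.2⟩
      rw [if_pos ha, if_neg hq, neg_zero, mul_zero]
    · rw [if_neg ha, neg_zero, mul_zero]

/-! ### Ranks of signed partial permutation matrices -/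

/-- A matrix supported on the cells `(i, j)` with `P i ∧ κ j = g i`, with the constant value `c`
there, has rank `≤ 1` as soon as `g` is constant on `P`: it is then the outer product `u ⊗ w` of the
indicator of `P` (times `c`) and the indicator of the admissible columns. [folklore] -/
theorem rank_le_one_of_forall_eq {m : ℕ} {β : Type*} [DecidableEq β] (P : Fin m → Prop)
    [DecidablePred P] (g κ : Fin m → β) (c : ℂ) (M : Matrix (Fin m) (Fin m) ℂ)
    (hM : ∀ i j, M i j = if P i ∧ κ j = g i then c else 0)
    (hg : ∀ i i', P i → P i' → g i = g i') : M.rank ≤ 1 := by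
  classical
  have hM' : M = Matrix.vecMulVec (fun i => if P i then c else 0)
      (fun j => if ∃ i, P i ∧ κ j = g i then 1 else 0) := by
    ext i j
    rw [hM, Matrix.vecMulVec_apply]
    by_cases hi : P i
    · by_cases hj : κ j = g i
      · rw [if_pos ⟨hi, hj⟩, if_pos hi, if_pos ⟨i, hi, hj⟩, mul_one]
      · have hne : ¬ ∃ i', P i' ∧ κ j = g i' := by
          rintro ⟨i', hi', hj'⟩
          exact hj (hj'.trans (hg i' i hi' hi))
        have hne' : ¬ (P i ∧ κ j = g i) := fun h => hj h.2
        rw [if_neg hne', if_pos hi, if_neg hne, mul_zero]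
    · have hne' : ¬ (P i ∧ κ j = g i) := fun h => hi h.1
      rw [if_neg hne', if_neg hi, zero_mul]
  rw [hM']
  exact Matrix.rank_vecMulVec_le _ _

/-- A matrix supported on the cells `(i, j)` with `P i ∧ κ j = g i`, with the constant value `c ≠ 0`
there, has rank `≥ 3` as soon as three admissible rows `r t` (`P (r t)`) have distinct targets
`g (r t)`, each hit by a column `s t` (`κ (s t) = g (r t)`): the `3 × 3` submatrix on these rows and
columns is `c • 1`. [folklore] -/
theorem three_le_rank_of_injective {m : ℕ} {β : Type*} [DecidableEq β] (P : Fin m → Prop)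
    [DecidablePred P] (g κ : Fin m → β) (c : ℂ) (hc : c ≠ 0) (M : Matrix (Fin m) (Fin m) ℂ)
    (hM : ∀ i j, M i j = if P i ∧ κ j = g i then c else 0) (r s : Fin 3 → Fin m)
    (hr : ∀ t, P (r t)) (hinj : Function.Injective fun t => g (r t)) (hs : ∀ t, κ (s t) = g (r t)) :
    3 ≤ M.rank := by
  have hsub : M.submatrix r s = c • (1 : Matrix (Fin 3) (Fin 3) ℂ) := by
    ext t t'
    rw [Matrix.submatrix_apply, hM, Matrix.smul_apply, Matrix.one_apply, smul_eq_mul, mul_ite,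
      mul_one, mul_zero, hs]
    by_cases h : t = t'
    · subst h
      rw [if_pos ⟨hr t, rfl⟩, if_pos rfl]
    · have hne : ¬ (P (r t) ∧ g (r t') = g (r t)) := fun h' => h (hinj h'.2).symm
      rw [if_neg hne, if_neg h]
  have hU : IsUnit (M.submatrix r s) := by
    rw [hsub, Matrix.isUnit_iff_isUnit_det, Matrix.det_smul, Matrix.det_one, mul_one,
      Fintype.card_fin]
    exact (IsUnit.mk0 c hc).pow 3
  calc 3 = (M.submatrix r s).rank := by rw [Matrix.rank_of_isUnit _ hU, Fintype.card_fin]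
    _ ≤ M.rank := Matrix.rank_submatrix_le _ _ _

/-! ### Counting the arcs of a given level avoiding a given point -/

/-- `n + 1 ≤ C(n + 1, q)` for `1 ≤ q ≤ n` (Pascal's rule and induction). [folklore] -/
theorem succ_le_choose : ∀ (n q : ℕ), 1 ≤ q → q ≤ n → n + 1 ≤ Nat.choose (n + 1) q := by
  intro n
  induction n with
  | zero => intro q h1 h0; omega
  | succ n ih =>
    intro q h1 hq
    rcases Nat.lt_or_ge q (n + 1) with hlt | hge
    · obtain ⟨q', rfl⟩ : ∃ q', q = q' + 1 := ⟨q - 1, by omega⟩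
      rw [Nat.choose_succ_succ']
      have h1' := ih (q' + 1) h1 (by omega)
      have h2' : 0 < Nat.choose (n + 1) q' := Nat.choose_pos (by omega)
      omega
    · obtain rfl : q = n + 1 := le_antisymm hq hge
      rw [Nat.choose_succ_self_right]

/-- A subset of `Fin (n + 1)` of cardinality `n` avoiding `p` is `univ.erase p`. [folklore] -/
theorem eq_univ_erase_of_card_eq {n : ℕ} {S : Finset (Fin (n + 1))} {p : Fin (n + 1)} (hp : p ∉ S)
    (hS : S.card = n) : S = Finset.univ.erase p := by
  refine Finset.eq_of_subset_of_card_le (fun x hx => Finset.mem_erase.mpr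
    ⟨fun h => hp (h ▸ hx), Finset.mem_univ x⟩) ?_
  rw [Finset.card_erase_of_mem (Finset.mem_univ p), Finset.card_univ, Fintype.card_fin, hS]
  omega

/-- For `1 ≤ q ≤ n` and `n ≥ 2` there are three distinct `q`-subsets of `Fin (n + 2)` avoiding a given
point `p` (the `q`-subsets of `univ.erase p` number `C(n + 1, q) ≥ n + 1 ≥ 3`), packaged as an
injection `Fin 3 → Finset (Fin (n + 2))`. [folklore] -/
theorem exists_three_subsets {n q : ℕ} (hn : 2 ≤ n) (h1 : 1 ≤ q) (hq : q ≤ n) (p : Fin (n + 2)) :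
    ∃ S : Fin 3 → Finset (Fin (n + 2)), Function.Injective S ∧ ∀ t, p ∉ S t ∧ (S t).card = q := by
  set U : Finset (Fin (n + 2)) := Finset.univ.erase p with hU
  have hUc : U.card = n + 1 := by
    rw [hU, Finset.card_erase_of_mem (Finset.mem_univ p), Finset.card_univ, Fintype.card_fin]
    rfl
  have h3 : 3 ≤ (Finset.powersetCard q U).card := by
    rw [Finset.card_powersetCard, hUc]
    exact le_trans (by omega) (succ_le_choose n q h1 hq)
  refine ⟨fun t => ((Finset.powersetCard q U).equivFin.symm (Fin.castLE h3 t) : Finset (Fin (n + 2))),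
    Subtype.coe_injective.comp ((Equiv.injective _).comp (Fin.castLE_injective h3)), fun t => ?_⟩
  have hmem := ((Finset.powersetCard q U).equivFin.symm (Fin.castLE h3 t)).2
  rw [Finset.mem_powersetCard] at hmem
  exact ⟨fun h => Finset.notMem_erase p Finset.univ (hmem.1 h), hmem.2⟩

/-! ### The registered stub -/

/-- **STUB V7** of line `Sketch` (phase 2) of crux `UniqStep`: for `n = k + 3 ≥ 4` (`m + 1 = 2ⁿ`) no
coefficient matrix `coeffMat (Grenet.repr ℂ n e) (p, q)` of Grenet's matrix has rank `2`.  It is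
`±` the partial permutation matrix of the arcs `S → insert p S` of level `|S| = q` avoiding `p`:
for `q ∈ {0, n - 1}` there is a single such arc (rank `≤ 1`), for `1 ≤ q ≤ n - 2` there are
`C(n - 1, q) ≥ 3` of them (rank `≥ 3`). [folklore] -/
theorem stub_grenetRank :
    ∀ (k m : ℕ), 1 ≤ k → m + 1 = 2 ^ (k + 3) →
    ∀ (e : Finset (Fin (k + 3)) ≃ Fin (m + 1)) (v : Fin (k + 3) × Fin (k + 3)),
      (coeffMat (Grenet.repr ℂ (k + 3) e) v).rank ≠ 2 := by
  intro k m hk _hm e v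
  obtain ⟨p, q⟩ := v
  set ρ : Fin m → Finset (Fin (k + 3)) := fun i => e.symm ((e Finset.univ).succAbove i)
  set κ : Fin m → Finset (Fin (k + 3)) := fun j => e.symm ((e ∅).succAbove j)
  set c : ℂ := -(-1 : ℂ) ^ ((e Finset.univ : ℕ) + (e ∅ : ℕ))
  have hM : ∀ i j, coeffMat (Grenet.repr ℂ (k + 3) e) (p, q) i j =
      if ((q : ℕ) = (ρ i).card ∧ p ∉ ρ i) ∧ κ j = insert p (ρ i) then c else 0 := fun i j => by
    rw [coeffMat_repr_eq]
    rfl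
  have hc0 : c ≠ 0 := neg_ne_zero.mpr (pow_ne_zero _ (neg_ne_zero.mpr one_ne_zero))
  by_cases hlow : (q : ℕ) = 0 ∨ (q : ℕ) = k + 2
  · -- a single arc of level `q` avoids `p`: rank `≤ 1`
    refine fun h2 => absurd (h2.symm.le.trans (rank_le_one_of_forall_eq
      (fun i => (q : ℕ) = (ρ i).card ∧ p ∉ ρ i) (fun i => insert p (ρ i)) κ c _ hM ?_)) (by norm_num)
    rintro i i' ⟨hi, hpi⟩ ⟨hi', hpi'⟩
    rcases hlow with h0 | htop
    · rw [Finset.card_eq_zero.mp (hi.symm.trans h0), Finset.card_eq_zero.mp (hi'.symm.trans h0)]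
    · rw [eq_univ_erase_of_card_eq hpi (hi.symm.trans htop),
        eq_univ_erase_of_card_eq hpi' (hi'.symm.trans htop)]
  · -- at least three arcs of level `q` avoid `p`: rank `≥ 3`
    have hq1 : 1 ≤ (q : ℕ) := by omega
    have hq2 : (q : ℕ) ≤ k + 1 := by have := q.isLt; omega
    obtain ⟨S, hSinj, hS⟩ := exists_three_subsets (n := k + 1) (by omega) hq1 hq2 p
    have hSu : ∀ t, S t ≠ Finset.univ := fun t h => (hS t).1 (h ▸ Finset.mem_univ p)
    choose r hr using fun t => Grenet.exists_rowSet_eq e (hSu t)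
    choose s hs using fun t => Grenet.exists_colSet_eq e (Finset.insert_ne_empty p (S t))
    refine fun h2 => absurd (h2.symm.ge.trans' (three_le_rank_of_injective
      (fun i => (q : ℕ) = (ρ i).card ∧ p ∉ ρ i) (fun i => insert p (ρ i)) κ c hc0 _ hM r s
      (fun t => ?_) (fun t t' h => ?_) (fun t => ?_))) (by norm_num)
    · show (q : ℕ) = (ρ (r t)).card ∧ p ∉ ρ (r t)
      rw [show ρ (r t) = S t from hr t]
      exact ⟨(hS t).2.symm, (hS t).1⟩
    · have h' : insert p (S t) = insert p (S t') := by
        have h'' : insert p (ρ (r t)) = insert p (ρ (r t')) := h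
        rwa [show ρ (r t) = S t from hr t, show ρ (r t') = S t' from hr t'] at h''
      refine hSinj ?_
      rw [← Finset.erase_insert (hS t).1, h', Finset.erase_insert (hS t').1]
    · show κ (s t) = insert p (ρ (r t))
      rw [show ρ (r t) = S t from hr t]
      exact hs t

end

end Summit.ValiantsHypothesis.ValiantsHypothesis.Theorems.ProjectionStabilityUniqStep
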